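import Summits.RiemannHypothesis.RiemannHypothesis.Theorems.WeilGroundStateGroundStatesConvergeToXiStubPhiIteratedDerivEnvelope
import Summits.RiemannHypothesis.RiemannHypothesis.Theorems.WeilGroundStateGroundStatesConvergeToXiStubMellinXi
import Summits.RiemannHypothesis.RiemannHypothesis.Theorems.WeilGroundStateGroundStatesConvergeToXiStubPsiDecay
import Summits.RiemannHypothesis.RiemannHypothesis.Theorems.WeilGroundStateGroundStatesConvergeToXiEnergyUpperTail
import Literature.NumberTheory.LFunctions.WeilExplicit
import Literature.NumberTheory.LFunctions.RiemannXi
import Mathlib.Analysis.Analytic.IsolatedZeros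
import Mathlib.Analysis.Analytic.Order
import Mathlib.Analysis.Complex.CauchyIntegral
import HarnessLib

/-!
# `WeilGroundState.GroundStatesConvergeToXi` — iterated Mellin division of Riemann's kernel
(crux item stmt-RiemannHypothesis-1527, route route-RiemannHypothesis-WeilGroundState; line `Sketch`,
stub `stub_phi_divide_iterate` (K4); `--supports`)

STRONG EXPONENTIAL WEIL CLASS with rate `1`: `F : ℝ → ℂ` smooth with `‖F^{(k)}(t)‖ ≤ C_k e^{-|t|}`
for every `k`.  Riemann's kernel `Φ(t) = 2Ψ(2t)` lies in it (`contDiff_phi`,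
`stub_phi_iteratedDeriv_envelope`) and `Φ̂ = weilMellin Φ = ξ` (`stub_mellinXi`).  CONSUMING the
division stub `stub_mellin_divide_strong` (K2) as a hypothesis, for every zero `s₀` of `ξ` in the
open critical strip we divide repeatedly by `s - s₀` inside the class while the current transform
still vanishes at `s₀` (`phiDiv_iterate`): after `j` steps `(s - s₀)^j F̂_j(s) = ξ(s)` in the closed
strip.  This must stop (`phiDiv_xi_not_flat`): `F̂_j` is continuous at `s₀` (dominated
convergence, `phiDiv_continuousAt_weilMellin`), so if it went on for `j = N + 1` with
`N = analyticOrderNatAt ξ s₀` (finite, since `ξ` is entire, `ξ(0) = 1/2`, and an entire function of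
infinite order at a point vanishes identically), the normal form `ξ = (s - s₀)^N g`, `g(s₀) ≠ 0`,
would give `g(s) = (s - s₀) F̂_{N+1}(s) → 0` as `s → s₀`, a contradiction.  The step at which it
stops produces `h` in the class with `(s - s₀)^m ĥ(s) = ξ(s)` in the closed strip and `ĥ(s₀) ≠ 0`.

No new definitions; no named fact is used.
-/

noncomputable section

set_option linter.dupNamespace false

open scoped Topology Real
open Filter Set MeasureTheory Complex

namespace Summit.RiemannHypothesis.RiemannHypothesis.Theorems.GroundStatesConvergeToXi

open Literature.NumberTheory.LFunctions

/-! ## Continuity of the transform in the open strip -/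

/-- If `F` is continuous with `‖F(t)‖ ≤ C e^{-|t|}`, then `F̂ = weilMellin F` is continuous at every
point `s₀` of the open critical strip `0 < Re s₀ < 1` (dominated convergence on the open strip,
where `‖F(t) e^{(s-1/2)t}‖ ≤ C e^{-|t|/2}`). [folklore] -/
theorem phiDiv_continuousAt_weilMellin {F : ℝ → ℂ} (hFc : Continuous F)
    (hFb : ∃ C : ℝ, ∀ t : ℝ, ‖F t‖ ≤ C * Real.exp (-(1 * |t|))) {s₀ : ℂ} (h0 : 0 < s₀.re)
    (h1 : s₀.re < 1) : ContinuousAt (weilMellin F) s₀ := by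
  obtain ⟨C, hC⟩ := hFb
  have hU : {s : ℂ | 0 < s.re ∧ s.re < 1} ∈ 𝓝 s₀ :=
    (isOpen_Ioo.preimage Complex.continuous_re).mem_nhds ⟨h0, h1⟩
  change ContinuousAt (fun s : ℂ => ∫ t : ℝ, F t * cexp ((s - 1 / 2) * t)) s₀
  refine continuousAt_of_dominated (bound := fun t : ℝ => C * Real.exp (-(1 / 2) * |t|))
    (Eventually.of_forall fun s =>
      (hFc.mul (by fun_prop : Continuous fun t : ℝ => cexp ((s - 1 / 2) * t))).aestronglyMeasurable)
    ?_ ((Literature.Analysis.Complex.integrable_exp_neg_mul_abs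
      (by norm_num : (0 : ℝ) < 1 / 2)).const_mul C)
    (ae_of_all _ fun t =>
      (by fun_prop : Continuous fun s : ℂ => F t * cexp ((s - 1 / 2) * t)).continuousAt)
  filter_upwards [hU] with s hs
  refine ae_of_all _ fun t => ?_
  rw [norm_mul, Complex.norm_exp]
  have hre : ((s - 1 / 2) * (t : ℂ)).re = (s.re - 1 / 2) * t := by simp [sub_re, mul_re]
  rw [hre]
  have h2 : (s.re - 1 / 2) * t ≤ 1 / 2 * |t| := by
    calc (s.re - 1 / 2) * t ≤ |(s.re - 1 / 2) * t| := le_abs_self _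
      _ = |s.re - 1 / 2| * |t| := abs_mul _ _
      _ ≤ 1 / 2 * |t| := mul_le_mul_of_nonneg_right
          (abs_le.2 ⟨by linarith [hs.1], by linarith [hs.2]⟩) (abs_nonneg _)
  calc ‖F t‖ * Real.exp ((s.re - 1 / 2) * t)
      ≤ C * Real.exp (-(1 * |t|)) * Real.exp (1 / 2 * |t|) :=
        mul_le_mul (hC t) (Real.exp_le_exp.2 h2) (Real.exp_pos _).le ((norm_nonneg _).trans (hC t))
    _ = C * Real.exp (-(1 / 2) * |t|) := by
        rw [mul_assoc, ← Real.exp_add]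
        congr 2
        ring

/-! ## `ξ` is not flat at any point of the strip -/

/-- **Termination.** For `s₀` in the open critical strip there is NO sequence of functions `F̂_j`,
continuous at `s₀`, with `(s - s₀)^j F̂_j(s) = ξ(s)` in the closed strip for every `j`: `ξ` is
entire and not identically zero (`ξ(0) = 1/2`), so `N = analyticOrderNatAt ξ s₀` is finite and
`ξ = (s - s₀)^N g` near `s₀` with `g(s₀) ≠ 0`; but then `g(s) = (s - s₀) F̂_{N+1}(s)` on a punctured
neighbourhood of `s₀`, whose limit at `s₀` is `0`. [folklore] -/
theorem phiDiv_xi_not_flat {s₀ : ℂ} (h0 : 0 < s₀.re) (h1 : s₀.re < 1) :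
    ¬ ∀ j : ℕ, ∃ Fh : ℂ → ℂ, ContinuousAt Fh s₀ ∧
        ∀ s : ℂ, 0 ≤ s.re → s.re ≤ 1 → (s - s₀) ^ j * Fh s = riemannXi s := by
  intro H
  have hξa : ∀ z : ℂ, AnalyticAt ℂ riemannXi z := fun z => differentiable_riemannXi.analyticAt z
  -- `ξ` is not locally zero at `s₀`
  have htop : analyticOrderAt riemannXi s₀ ≠ ⊤ := by
    intro h
    have hz := (AnalyticOnNhd.analyticOrderAt_eq_top_iff_eq_zero s₀ hξa).1 h
    have h2 := riemannXi_zero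
    rw [hz, Pi.zero_apply] at h2
    norm_num at h2
  obtain ⟨g, hg, hg0, hfg⟩ := (hξa s₀).analyticOrderAt_ne_top.1 htop
  obtain ⟨Fh, hFh, hF⟩ := H (analyticOrderNatAt riemannXi s₀ + 1)
  have hU : {s : ℂ | 0 < s.re ∧ s.re < 1} ∈ 𝓝 s₀ :=
    (isOpen_Ioo.preimage Complex.continuous_re).mem_nhds ⟨h0, h1⟩
  -- on the punctured neighbourhood, `g z = (z - s₀) F̂ z`
  have hev : ∀ᶠ z in 𝓝[≠] s₀, g z = (z - s₀) * Fh z := by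
    filter_upwards [self_mem_nhdsWithin, hfg.filter_mono nhdsWithin_le_nhds,
      mem_nhdsWithin_of_mem_nhds hU] with z hz hξz hzU
    have hne : (z - s₀) ^ analyticOrderNatAt riemannXi s₀ ≠ 0 :=
      pow_ne_zero _ (sub_ne_zero_of_ne hz)
    have e := hF z hzU.1.le hzU.2.le
    rw [hξz, smul_eq_mul, pow_succ, mul_assoc] at e
    exact (mul_left_cancel₀ hne e).symm
  have hlim1 : Tendsto g (𝓝[≠] s₀) (𝓝 (g s₀)) := hg.continuousAt.continuousWithinAt
  have hc : ContinuousAt (fun z : ℂ => (z - s₀) * Fh z) s₀ :=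
    (continuousAt_id.sub continuousAt_const).mul hFh
  have hlim2 : Tendsto (fun z : ℂ => (z - s₀) * Fh z) (𝓝[≠] s₀) (𝓝 ((s₀ - s₀) * Fh s₀)) :=
    hc.continuousWithinAt
  rw [sub_self, zero_mul] at hlim2
  exact hg0 (tendsto_nhds_unique_of_eventuallyEq hlim1 hlim2 hev)

/-! ## The iteration -/

/-- **Iterated division.** Consuming the division stub (K2): for `s₀` in the open strip and every
`j`, either there is `F` in the strong class (rate `1`) with `(s - s₀)^j F̂(s) = ξ(s)` in the closed
strip (all previous transforms vanished at `s₀` and were divided), or the division has already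
stopped at some `h` in the class with `(s - s₀)^m ĥ(s) = ξ(s)` in the closed strip and
`ĥ(s₀) ≠ 0`.  Start: `F₀ = Φ`, `Φ̂ = ξ` (`stub_mellinXi`). [folklore] -/
theorem phiDiv_iterate
    (hK2 : ∀ (F : ℝ → ℂ) (b₀ : ℝ) (s₀ : ℂ), ContDiff ℝ (⊤ : ℕ∞) F → 1 / 2 < b₀ →
      (∀ k : ℕ, ∃ C : ℝ, ∀ t : ℝ, ‖iteratedDeriv k F t‖ ≤ C * Real.exp (-(b₀ * |t|))) →
      0 < s₀.re → s₀.re < 1 → weilMellin F s₀ = 0 →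
      ∃ G : ℝ → ℂ, ContDiff ℝ (⊤ : ℕ∞) G ∧
        (∀ k : ℕ, ∃ C : ℝ, ∀ t : ℝ, ‖iteratedDeriv k G t‖ ≤ C * Real.exp (-(b₀ * |t|))) ∧
        (∀ t, deriv G t = -(s₀ - 1 / 2) * G t - F t) ∧
        ∀ s : ℂ, 0 ≤ s.re → s.re ≤ 1 → weilMellin F s = (s - s₀) * weilMellin G s)
    {s₀ : ℂ} (h0 : 0 < s₀.re) (h1 : s₀.re < 1) (j : ℕ) :
    (∃ F : ℝ → ℂ, ContDiff ℝ (⊤ : ℕ∞) F ∧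
        (∀ k : ℕ, ∃ C : ℝ, ∀ t : ℝ, ‖iteratedDeriv k F t‖ ≤ C * Real.exp (-(1 * |t|))) ∧
        ∀ s : ℂ, 0 ≤ s.re → s.re ≤ 1 → (s - s₀) ^ j * weilMellin F s = riemannXi s) ∨
      ∃ (m : ℕ) (h : ℝ → ℂ), ContDiff ℝ (⊤ : ℕ∞) h ∧
        (∀ k : ℕ, ∃ C : ℝ, ∀ t : ℝ, ‖iteratedDeriv k h t‖ ≤ C * Real.exp (-(1 * |t|))) ∧
        (∀ s : ℂ, 0 ≤ s.re → s.re ≤ 1 → (s - s₀) ^ m * weilMellin h s = riemannXi s) ∧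
        weilMellin h s₀ ≠ 0 := by
  induction j with
  | zero =>
    refine Or.inl ⟨fun t : ℝ => (2 : ℂ) * LagariasMontague.Psic (2 * t), contDiff_phi,
      stub_phi_iteratedDeriv_envelope, fun s _ _ => ?_⟩
    rw [pow_zero, one_mul]
    exact stub_mellinXi stub_psiDecay.1 stub_psiDecay.2 s
  | succ j ih =>
    rcases ih with ⟨F, hF, hFb, hFm⟩ | hfound
    · by_cases hz : weilMellin F s₀ = 0
      · obtain ⟨G, hG, hGb, -, hGm⟩ := hK2 F 1 s₀ hF (by norm_num) hFb h0 h1 hz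
        refine Or.inl ⟨G, hG, hGb, fun s hs0 hs1 => ?_⟩
        rw [← hFm s hs0 hs1, hGm s hs0 hs1, pow_succ, mul_assoc]
      · exact Or.inr ⟨j, F, hF, hFb, hFm, hz⟩
    · exact Or.inr hfound

/-! ## The stub -/

/-- **Stub `stub_phi_divide_iterate` (K4).** Consuming the division stub `stub_mellin_divide_strong`
(K2) as its hypothesis: for every zero `s₀` of `ξ` in the open critical strip there are `m : ℕ` and
`h` in the strong exponential Weil class with rate `1` (smooth, `‖h^{(k)}(t)‖ ≤ C_k e^{-|t|}`) such
that `(s - s₀)^m ĥ(s) = ξ(s)` in the closed strip and `ĥ(s₀) ≠ 0` — iterated Mellin division of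
Riemann's kernel `Φ(t) = 2Ψ(2t)` (`phiDiv_iterate`), which terminates because `ξ` is entire and
`ξ(0) = 1/2 ≠ 0` (`phiDiv_xi_not_flat`, `phiDiv_continuousAt_weilMellin`). [folklore] -/
theorem stub_phi_divide_iterate :
    (∀ (F : ℝ → ℂ) (b₀ : ℝ) (s₀ : ℂ), ContDiff ℝ (⊤ : ℕ∞) F → 1 / 2 < b₀ →
      (∀ k : ℕ, ∃ C : ℝ, ∀ t : ℝ, ‖iteratedDeriv k F t‖ ≤ C * Real.exp (-(b₀ * |t|))) →
      0 < s₀.re → s₀.re < 1 → weilMellin F s₀ = 0 →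
      ∃ G : ℝ → ℂ, ContDiff ℝ (⊤ : ℕ∞) G ∧
        (∀ k : ℕ, ∃ C : ℝ, ∀ t : ℝ, ‖iteratedDeriv k G t‖ ≤ C * Real.exp (-(b₀ * |t|))) ∧
        (∀ t, deriv G t = -(s₀ - 1 / 2) * G t - F t) ∧
        ∀ s : ℂ, 0 ≤ s.re → s.re ≤ 1 → weilMellin F s = (s - s₀) * weilMellin G s) →
    ∀ s₀ : ℂ, 0 < s₀.re → s₀.re < 1 → riemannXi s₀ = 0 →
      ∃ (m : ℕ) (h : ℝ → ℂ), ContDiff ℝ (⊤ : ℕ∞) h ∧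
        (∀ k : ℕ, ∃ C : ℝ, ∀ t : ℝ, ‖iteratedDeriv k h t‖ ≤ C * Real.exp (-(1 * |t|))) ∧
        (∀ s : ℂ, 0 ≤ s.re → s.re ≤ 1 → (s - s₀) ^ m * weilMellin h s = riemannXi s) ∧
        weilMellin h s₀ ≠ 0 := by
  intro hK2 s₀ h0 h1 _
  by_contra hne
  refine phiDiv_xi_not_flat h0 h1 fun j => ?_
  rcases phiDiv_iterate hK2 h0 h1 j with ⟨F, hF, hFb, hFm⟩ | hfound
  · obtain ⟨C, hC⟩ := hFb 0
    simp only [iteratedDeriv_zero] at hC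
    exact ⟨weilMellin F, phiDiv_continuousAt_weilMellin hF.continuous ⟨C, hC⟩ h0 h1, hFm⟩
  · exact absurd hfound hne

end Summit.RiemannHypothesis.RiemannHypothesis.Theorems.GroundStatesConvergeToXi

end
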